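import Summits.PneNP.PneNP.Theorems.IP3ExpandingCount

/-!
# Density-uniform expanding pure `IP₃` instances, I: bad outcomes at ratio `(3t+1)/t` and the union bound
(cell `pnp-ideate`, ROUND-23 T23.1-A)

FRONTIER range-avoidance ladder, rung F-N3 context (restricted-model combinatorics; nothing here bears on `P` vs `NP`).
The ROUND-22 random pure-`IP₃` model `IP3ExpandingModel` (outcome `ω : Fin m → (Fin 6 ↪ Fin N)`, instance `inst6 ω` on `N`
variables) with the expansion RATIO THREADED as in `PstarDensityCount`: for `t ≥ 1` an outcome is `badD t r` if some `≤ r`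
outputs `J` read fewer than `(9t+1)/(2t)·|J|` variables; otherwise `inst6 ω` is `(r, (3t+1)/t)`-boundary expanding
(`boundaryExpandingQ_of_not_badD`, via `2|N(J)| ≤ |bdry J| + 6|J|`).  Threshold `vD t f = ((9t+1)f − 1)/(2t)` (`le_vD_of_lt`,
`vD_le : ≤ 5f`), the SLACK `slackD_le : (t−1)·f ≤ 2t·(5f − vD t f)` (the exponent `(t−1)/(2t)` of the density-uniform first
moment), the cover by the ROUND-22 cylinders `IP3ExpandingCount.cyl6` and **the union bound** `card_badSetD_le`:
`#badD ≤ Σ_{i<r} C(m, i+1)·C(N, vD t (i+1))·((vD t (i+1))⁶)^{i+1}·Q^{m−(i+1)}`.  Part II (`IP3DensityExist`) does the estimate.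
-/

set_option linter.dupNamespace false

open Finset Literature.Computability.Complexity
open Summit.PneNP.PneNP.Theorems.PstarSALevel (varSet bdry)
open Summit.PneNP.PneNP.Theorems.PstarSASDPLevel (BoundaryExpandingQ)
open Summit.PneNP.PneNP.Theorems.PstarSAClosure (nbhd)
open Summit.PneNP.PneNP.Theorems.PstarExpandingModel (two_card_nbhd_le)
open Summit.PneNP.PneNP.Theorems.IP3ExpandingModel
open Summit.PneNP.PneNP.Theorems.IP3ExpandingCount (cyl6 mem_cyl6 card_cyl6 card_cyl6_le)

namespace Summit.PneNP.PneNP.Theorems.IP3DensityCount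

variable {n N m : ℕ}

/-! ## Vertex expansion ⇒ boundary expansion at ratio `(3t+1)/t` -/

/-- **Vertex expansion ⇒ boundary expansion** (`k = 6`, ratio `(3t+1)/t`): if every `≤ r` outputs `J` read at least
`(9t+1)/(2t)·|J|` variables then the instance is `(r, (3t+1)/t)`-boundary expanding. -/
theorem boundaryExpandingQ_of_vertexExpanding6D (I : LocalMap 6 n m) (hI : ∀ j, Function.Injective (I.vars j)) (t r : ℕ)
    (h : ∀ J : Finset (Fin m), J.card ≤ r → (9 * t + 1) * J.card ≤ 2 * t * (nbhd I J).card) :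
    BoundaryExpandingQ (3 * t + 1) t r I := by
  intro J hJ
  have h1 := h J hJ
  have h2 : t * (2 * (nbhd I J).card) ≤ t * ((bdry I J).card + 6 * J.card) := Nat.mul_le_mul_left t (two_card_nbhd_le I hI J)
  nlinarith [h1, h2]

/-! ## Bad outcomes -/

/-- An outcome is BAD at radius `r` and parameter `t` if some `≤ r` outputs read fewer than `(9t+1)/(2t)` variables each on
average. -/
def badD (t r : ℕ) (ω : Outcome6 N m) : Prop :=
  ∃ J : Finset (Fin m), J.card ≤ r ∧ ¬((9 * t + 1) * J.card ≤ 2 * t * (nbhd (inst6 ω) J).card)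

/-- A good outcome gives an `(r, (3t+1)/t)`-boundary expanding instance. -/
theorem boundaryExpandingQ_of_not_badD (t r : ℕ) (ω : Outcome6 N m) (h : ¬badD t r ω) :
    BoundaryExpandingQ (3 * t + 1) t r (inst6 ω) := by
  refine boundaryExpandingQ_of_vertexExpanding6D (inst6 ω) (fun j => (ω j).injective) t r fun J hJ => ?_
  by_contra hlt
  exact h ⟨J, hJ, hlt⟩

/-- Badness is monotone in the radius. -/
theorem badD_mono {t r r' : ℕ} (hrr : r ≤ r') {ω : Outcome6 N m} (h : badD t r ω) : badD t r' ω := by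
  obtain ⟨J, hJ, hbad⟩ := h
  exact ⟨J, hJ.trans hrr, hbad⟩

/-! ## The threshold and the slack -/

/-- The threshold `vD t f = ((9t+1)f − 1)/(2t)`: the largest vertex count of a bad family of size `f ≥ 1`. -/
def vD (t f : ℕ) : ℕ := ((9 * t + 1) * f - 1) / (2 * t)

/-- A bad set of size `f` reads at most `vD t f` variables: `2tV < (9t+1)f ⇒ V ≤ vD t f`. -/
theorem le_vD_of_lt {t f V : ℕ} (ht : 1 ≤ t) (h : ¬((9 * t + 1) * f ≤ 2 * t * V)) : V ≤ vD t f := by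
  unfold vD
  rw [Nat.le_div_iff_mul_le (by omega), Nat.mul_comm]
  exact Nat.le_sub_one_of_lt (lt_of_not_ge h)

/-- `2t · vD t f ≤ (9t+1)f − 1`. -/
theorem two_t_vD_le (t f : ℕ) : 2 * t * vD t f ≤ (9 * t + 1) * f - 1 := by
  unfold vD
  rw [Nat.mul_comm]
  exact Nat.div_mul_le_self _ _

/-- `vD t f ≤ 5f`. -/
theorem vD_le (t f : ℕ) (ht : 1 ≤ t) : vD t f ≤ 5 * f := by
  unfold vD
  calc ((9 * t + 1) * f - 1) / (2 * t) ≤ (2 * t * (5 * f)) / (2 * t) :=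
        Nat.div_le_div_right (by
          have : (9 * t + 1) * f ≤ 2 * t * (5 * f) := by nlinarith
          omega)
    _ = 5 * f := Nat.mul_div_cancel_left _ (by omega)

/-- `1 ≤ vD t f` for `t, f ≥ 1`. -/
theorem one_le_vD {t f : ℕ} (ht : 1 ≤ t) (hf : 1 ≤ f) : 1 ≤ vD t f := by
  unfold vD
  rw [Nat.le_div_iff_mul_le (by omega)]
  have : 9 * t + 1 ≤ (9 * t + 1) * f := Nat.le_mul_of_pos_right _ hf
  omega

/-- **The slack**: a bad family of size `f ≥ 1` repeats at least `(t−1)/(2t)·f` incidences, `(t−1)·f ≤ 2t·(5f − vD t f)`. -/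
theorem slackD_le (t f : ℕ) (ht : 1 ≤ t) (hf : 1 ≤ f) : (t - 1) * f ≤ 2 * t * (5 * f - vD t f) := by
  have h1 := two_t_vD_le t f
  have h2 := vD_le t f ht
  have h3 : 1 ≤ (9 * t + 1) * f := by nlinarith
  zify [h2, ht, h3] at h1 ⊢
  nlinarith

/-! ## The cover and its size -/

/-- The bad outcomes. -/
noncomputable def badSetD (N m t r : ℕ) : Finset (Outcome6 N m) := by
  classical exact univ.filter fun ω => badD t r ω

/-- The covering family: over sizes `f = i + 1`, `i < r`, sets `J` of that size and vertex sets of size `vD t f`. -/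
noncomputable def coverD (N m t r : ℕ) : Finset (Outcome6 N m) :=
  (Finset.range r).biUnion fun i => ((univ : Finset (Fin m)).powersetCard (i + 1)).biUnion fun J =>
    ((univ : Finset (Fin N)).powersetCard (vD t (i + 1))).biUnion fun A => cyl6 J A

/-- **Containment**: if `5r ≤ N`, every bad outcome lies in the cover. -/
theorem badSetD_subset {t : ℕ} (ht : 1 ≤ t) (r : ℕ) (hr : 5 * r ≤ N) : badSetD N m t r ⊆ coverD N m t r := by
  classical
  intro ω hω
  simp only [badSetD, Finset.mem_filter, Finset.mem_univ, true_and] at hω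
  obtain ⟨J, hJr, hJ⟩ := hω
  have hs : 1 ≤ J.card := by
    rw [Nat.one_le_iff_ne_zero]
    intro h0
    rw [Finset.card_eq_zero] at h0
    subst h0
    exact hJ (by simp)
  have hV : (nbhd (inst6 ω) J).card ≤ vD t J.card := le_vD_of_lt ht hJ
  have hvN : vD t J.card ≤ N := (vD_le t _ ht).trans (by omega)
  obtain ⟨A, hA, hmem⟩ := exists_set_of_small_nbhd6 ω J (vD t J.card) hvN hV
  simp only [coverD, Finset.mem_biUnion, Finset.mem_range, Finset.mem_powersetCard]
  refine ⟨J.card - 1, by omega, J, ⟨Finset.subset_univ _, by omega⟩, A, ⟨Finset.subset_univ _, ?_⟩, mem_cyl6.2 hmem⟩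
  rw [hA]; congr 1; omega

/-! ## The union bound -/

/-- **The union bound.**  If `5r ≤ N` then
`|badD| ≤ Σ_{i<r} C(m, i+1)·C(N, vD t (i+1))·((vD t (i+1))⁶)^{i+1}·Q^{m−(i+1)}`. -/
theorem card_badSetD_le {t : ℕ} (ht : 1 ≤ t) (r : ℕ) (hr : 5 * r ≤ N) :
    ((badSetD N m t r).card : ℝ) ≤ ∑ i ∈ Finset.range r,
      (m.choose (i + 1) : ℝ) * (N.choose (vD t (i + 1)) : ℝ) * (((vD t (i + 1) : ℕ) : ℝ) ^ 6) ^ (i + 1) *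
        (Fintype.card (Fin 6 ↪ Fin N) : ℝ) ^ (m - (i + 1)) := by
  classical
  have h0 : ((badSetD N m t r).card : ℝ) ≤ ((coverD N m t r).card : ℝ) := by
    exact_mod_cast Finset.card_le_card (badSetD_subset ht r hr)
  refine h0.trans ?_
  unfold coverD
  refine (Nat.cast_le.2 Finset.card_biUnion_le).trans ?_
  push_cast
  refine Finset.sum_le_sum fun i _ => ?_
  refine (Nat.cast_le (α := ℝ).2 Finset.card_biUnion_le).trans ?_
  push_cast
  have hJ : ∀ J ∈ (univ : Finset (Fin m)).powersetCard (i + 1),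
      ((((univ : Finset (Fin N)).powersetCard (vD t (i + 1))).biUnion fun A => cyl6 J A).card : ℝ) ≤
        (N.choose (vD t (i + 1)) : ℝ) * (((vD t (i + 1) : ℕ) : ℝ) ^ 6) ^ (i + 1) *
          (Fintype.card (Fin 6 ↪ Fin N) : ℝ) ^ (m - (i + 1)) := by
    intro J hJ
    rw [Finset.mem_powersetCard] at hJ
    refine (Nat.cast_le (α := ℝ).2 Finset.card_biUnion_le).trans ?_
    push_cast
    have hterm : ∀ A ∈ (univ : Finset (Fin N)).powersetCard (vD t (i + 1)), ((cyl6 J A).card : ℝ) ≤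
        (((vD t (i + 1) : ℕ) : ℝ) ^ 6) ^ (i + 1) * (Fintype.card (Fin 6 ↪ Fin N) : ℝ) ^ (m - (i + 1)) := by
      intro A hA
      rw [Finset.mem_powersetCard] at hA
      have := card_cyl6_le (m := m) J hA.2
      rwa [hJ.2] at this
    refine (Finset.sum_le_sum hterm).trans ?_
    rw [Finset.sum_const, nsmul_eq_mul, Finset.card_powersetCard, Finset.card_univ, Fintype.card_fin]
    exact le_of_eq (by ring)
  refine (Finset.sum_le_sum hJ).trans ?_
  have hc : ((univ : Finset (Fin m)).powersetCard (i + 1)).card = m.choose (i + 1) := by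
    rw [Finset.card_powersetCard, Finset.card_univ, Fintype.card_fin]
  rw [Finset.sum_const, nsmul_eq_mul, hc]
  exact le_of_eq (by ring)

end Summit.PneNP.PneNP.Theorems.IP3DensityCount
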